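import Literature.Computability.FineGrained.SplitAndListOV
import Literature.Computability.FineGrained.OVFromSETH
import HarnessLib

/-!
# SETH ⇒ OV: the split-and-list instance in the regime `d = c log N`

The Orthogonal-Vectors instance behind the named fact
`Literature.Computability.FineGrained.sparseKSATInRAMTime_of_ov_subquadratic` of
`…FineGrained.OVFromSETH` (R. Williams, *A new algorithm for optimal 2-constraint satisfaction and
its implications*, TCS 348 (2005), §5.1, Thm. 5 of the author's version; V. Vassilevska Williams,
Proc. ICM 2018, §3, proof of Thm. 3.1, in the OV form: coordinate `j` of `u_p` is `0` iff the
first-half assignment `p` satisfies clause `j`, likewise for `v_q`, so that `⟨u_p, v_q⟩ = 0` iff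
`(p, q)` satisfies every clause). The split-and-list core — the halves `SplitList.half`, the
satisfaction bit `SplitList.satW φ h side w j` of clause `j` by the assignment word `w` through a
literal of side `side`, the unpadded instance `SplitList.splitOV φ` of dimension `m` and Williams'
correspondence `SplitList.hasOrthogonalPair_splitOV_iff`, together with the generic lemmas on the
`OV` encoding — is the landed `…FineGrained.SplitAndListOV`; this file adds what the regime
`d = c ⌊log₂ N⌋` of `OVWithDim c` (the hypothesis of the named fact) needs on top of it:

* `OVRed.litSat h P side l`: the literal-level bit of which `satW` is the disjunction
  (`OVRed.satW_eq_any_litSat`) — the unit the word-RAM row pass of the planned companion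
  `…OVFromSETHReductionProgram` (next proposal of this unit) accumulates literal by literal;
* `OVRed.vecBit φ h P side j = [j < m] ∧ ¬ satW φ h side P j`: the coordinates **padded by `0`**
  past the last clause, and `OVRed.splitOV φ c`: the instance with `N = 2^h` vectors per side and
  dimension `d = c · h` (so that it lies in the regime `d = c ⌊log₂ N⌋`, `OVRed.splitOV_mem`;
  `OVRed.splitInst φ c : (OVWithDim c).Inst`);
* **correctness** `OVRed.hasOrthogonalPair_splitOV_iff`: if all `m` clauses fit (`m ≤ c h`), the
  padded instance has an orthogonal pair iff `φ` is satisfiable (from the unpadded correspondence: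
  the padding coordinates are `0` on both sides), and the accepted output
  `OVRed.OVWithDim_good_splitInst`;
* the length `2 N d + 2` and the input width `Nat.size (2 N d + 2)` of its `OV` encoding
  (`OVRed.length_encode_splitOV`, `OVRed.inputWidth_encode_splitOV`, for `c ≥ 1`), which determine
  the memory the reduction program must present to the emulated OV program and its word size.

## References

* R. Williams, *A new algorithm for optimal 2-constraint satisfaction and its implications*,
  Theoret. Comput. Sci. 348 (2005) 357–365, §5.1 (Thm. 5.1; Theorem 5 of the author's version).
* V. Vassilevska Williams, *On some fine-grained questions in algorithms and complexity*,
  Proc. ICM 2018, §3, Thm. 3.1 (proof).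
-/

namespace Literature.Computability.FineGrained

open Cryptography Complexity

namespace OVRed

open SplitList (half satW)

/-! ### The literal-level satisfaction bit -/

/-- Literal `l` is satisfied by the assignment word `P` through a literal of side `side`
(`true`: its variable is `< h`; `false`: its variable is `≥ h`): the side matches and bit `l.1` of
`P` is the polarity — the summand of `SplitList.satW`. (Williams 2005, §5.1, proof of Thm. 5:
"`p` satisfies `c_j`".) [folklore] -/
def litSat (h P : ℕ) (side : Bool) (l : Literal ℕ) : Bool :=
  (decide (l.1 < h) == side) && (P.testBit l.1 == l.2)

/-- `satW` is the disjunction of `litSat` over the literals of the clause. [folklore] -/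
theorem satW_eq_any_litSat (φ : CNF ℕ) (h : ℕ) (side : Bool) (P j : ℕ) :
    satW φ h side P j = (φ.getD j []).any (litSat h P side) := rfl

/-! ### The padded coordinates and the instance -/

/-- Coordinate `j` of the vector of the assignment word `P` (side `side`): `1` iff clause `j`
exists and is **not** satisfied by `P` through a literal of that side; the padding coordinates
`j ≥ m` are `0` (Williams 2005, §5.1: `c_j ∈ S_p` iff `p` does not satisfy `c_j`). [folklore] -/
def vecBit (φ : CNF ℕ) (h P : ℕ) (side : Bool) (j : ℕ) : Bool :=
  decide (j < φ.length) && !satW φ h side P j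

/-- Past the last clause every coordinate is `0`. [folklore] -/
theorem vecBit_of_le {φ : CNF ℕ} {j : ℕ} (hj : φ.length ≤ j) (h P : ℕ) (side : Bool) :
    vecBit φ h P side j = false := by
  simp [vecBit, not_lt.2 hj]

/-- Inside the clause list, the coordinate is the negated satisfaction bit. [folklore] -/
theorem vecBit_of_lt {φ : CNF ℕ} {j : ℕ} (hj : j < φ.length) (h P : ℕ) (side : Bool) :
    vecBit φ h P side j = !satW φ h side P j := by
  simp [vecBit, hj]

/-- **The split-and-list OV instance in dimension `d = c h`**: `N = 2^h` vectors per side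
(`h = half (numVars φ)`), dimension `d = c · h`; vector `p` of the first list has coordinate `j`
equal to `1` iff clause `j` exists and is not satisfied by the first-half assignment `p`, vector
`q` of the second list likewise for the second-half assignment `q` (presented as the word
`q · 2^h`); coordinates `j ≥ m` are `0`. This is `SplitList.splitOV φ` padded from dimension `m` to
`c h`, the instance of the proof of VVW ICM 2018, Thm. 3.1 (Williams 2005, §5.1, proof of Thm. 5).
[cite: WilliamsTCS2005, §5.1 (proof of Thm. 5.1)] -/
def splitOV (φ : CNF ℕ) (c : ℕ) : OVInstance where
  n := 2 ^ half φ.numVars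
  d := c * half φ.numVars
  A := fun p j => vecBit φ (half φ.numVars) p true j
  B := fun q j => vecBit φ (half φ.numVars) (q * 2 ^ half φ.numVars) false j

/-- The number of vectors is `N = 2^h`. [folklore] -/
@[simp] theorem splitOV_n (φ : CNF ℕ) (c : ℕ) : (splitOV φ c).n = 2 ^ half φ.numVars := rfl

/-- The dimension is `d = c h`. [folklore] -/
@[simp] theorem splitOV_d (φ : CNF ℕ) (c : ℕ) : (splitOV φ c).d = c * half φ.numVars := rfl

/-- **The instance lies in the regime `d = c ⌊log₂ N⌋`** of `OVWithDim c`. [folklore] -/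
theorem splitOV_mem (φ : CNF ℕ) (c : ℕ) :
    splitOV φ c ∈ {I : OVInstance | I.d = c * Nat.log 2 I.n} := by
  show c * half φ.numVars = c * Nat.log 2 (2 ^ half φ.numVars)
  rw [Nat.log_pow one_lt_two]

/-- The split instance as an instance of `OVWithDim c`. [folklore] -/
def splitInst (φ : CNF ℕ) (c : ℕ) : (OVWithDim c).Inst := ⟨splitOV φ c, splitOV_mem φ c⟩

/-- Its size is `N`. [folklore] -/
@[simp] theorem OVWithDim_size_splitInst (φ : CNF ℕ) (c : ℕ) :
    (OVWithDim c).size (splitInst φ c) = 2 ^ half φ.numVars := rfl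

/-- Its encoding is the `OV` encoding of `splitOV φ c`. [folklore] -/
theorem OVWithDim_encode_splitInst (φ : CNF ℕ) (c : ℕ) :
    (OVWithDim c).encode (splitInst φ c) = OV.encode (splitOV φ c) := rfl

/-! ### Correctness -/

/-- **Correctness of the padded instance** (Williams 2005, §5.1, Thm. 5; VVW ICM 2018, Thm. 3.1,
proof): if all `m` clauses fit into the dimension (`m ≤ c h`), the instance has an orthogonal pair
iff `φ` is satisfiable — the padding coordinates are `0` on both sides, so orthogonal pairs are
those of the unpadded instance `SplitList.splitOV φ` (`SplitList.hasOrthogonalPair_splitOV_iff`).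
[cite: WilliamsTCS2005, §5.1 (proof of Thm. 5.1)] -/
theorem hasOrthogonalPair_splitOV_iff {φ : CNF ℕ} {c : ℕ} (hm : φ.length ≤ c * half φ.numVars) :
    (splitOV φ c).HasOrthogonalPair ↔ φ.Satisfiable := by
  rw [← SplitList.hasOrthogonalPair_splitOV_iff φ]
  constructor
  · rintro ⟨p, q, hpq⟩
    refine ⟨p, q, fun j hj => hpq ⟨j, lt_of_lt_of_le j.2 hm⟩ ?_⟩
    have hjm : (j : ℕ) < φ.length := j.2
    show vecBit φ (half φ.numVars) p true j = true ∧
      vecBit φ (half φ.numVars) (q * 2 ^ half φ.numVars) false j = true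
    rw [vecBit_of_lt hjm, vecBit_of_lt hjm]
    exact hj
  · rintro ⟨p, q, hpq⟩
    refine ⟨p, q, fun j hj => ?_⟩
    change vecBit φ (half φ.numVars) p true j = true ∧
      vecBit φ (half φ.numVars) (q * 2 ^ half φ.numVars) false j = true at hj
    rcases Nat.lt_or_ge (j : ℕ) φ.length with hjm | hjm
    · rw [vecBit_of_lt hjm, vecBit_of_lt hjm] at hj
      exact hpq ⟨j, hjm⟩ hj
    · rw [vecBit_of_le hjm] at hj
      exact Bool.false_ne_true hj.1

open scoped Classical in
/-- **The accepted output on the split instance**: `[1]` if `φ` is satisfiable, `[0]` otherwise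
(all clauses fitting). [folklore] -/
theorem OVWithDim_good_splitInst {φ : CNF ℕ} {c : ℕ} (hm : φ.length ≤ c * half φ.numVars) :
    (OVWithDim c).Good (splitInst φ c) = {[if φ.Satisfiable then 1 else 0]} := by
  have key : (OVWithDim c).Good (splitInst φ c) = OV.Good (splitOV φ c) := rfl
  rw [key]
  by_cases hs : φ.Satisfiable
  · rw [if_pos hs]
    exact FGProblem.ofPred_good_of_pos _ _ _ _ ((hasOrthogonalPair_splitOV_iff hm).2 hs)
  · rw [if_neg hs]
    exact FGProblem.ofPred_good_of_neg _ _ _ _ (mt (hasOrthogonalPair_splitOV_iff hm).1 hs)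

/-! ### Length and width of the encoding -/

/-- The encoding has length `2 N d + 2`. [folklore] -/
theorem length_encode_splitOV (φ : CNF ℕ) (c : ℕ) :
    (OV.encode (splitOV φ c)).length = 2 * ((splitOV φ c).n * (splitOV φ c).d) + 2 := by
  rw [length_OV_encode]; ring

/-- For `c ≥ 1` the number of vectors is at most the length of the encoding (if `d = 0` then
`h = 0` and `N = 1`). [folklore] -/
theorem splitOV_n_le (φ : CNF ℕ) {c : ℕ} (hc : 1 ≤ c) :
    (splitOV φ c).n ≤ 2 + 2 * ((splitOV φ c).n * (splitOV φ c).d) := by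
  simp only [splitOV_n, splitOV_d]
  rcases Nat.eq_zero_or_pos (half φ.numVars) with h0 | hpos
  · rw [h0]; simp
  · have h1 : 0 < c * half φ.numVars := Nat.mul_pos (by omega) hpos
    have := Nat.le_mul_of_pos_right (2 ^ half φ.numVars) h1
    omega

/-- **The input width of the split instance** is `Nat.size (2 N d + 2)` (for `c ≥ 1`): the length
of the encoding dominates every word (`inputWidth_OV_encode`). This is the width at which the
hypothetical OV program is run. [folklore] -/
theorem inputWidth_encode_splitOV (φ : CNF ℕ) {c : ℕ} (hc : 1 ≤ c) :
    WordRAM.inputWidth (OV.encode (splitOV φ c)) =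
      Nat.size (2 * ((splitOV φ c).n * (splitOV φ c).d) + 2) := by
  rw [inputWidth_OV_encode (I := splitOV φ c) Nat.one_le_two_pow, max_eq_left (splitOV_n_le φ hc),
    Nat.add_comm]

/-- The width of the split instance as an `OVWithDim c` instance. [folklore] -/
theorem OVWithDim_width_splitInst (φ : CNF ℕ) {c : ℕ} (hc : 1 ≤ c) :
    (OVWithDim c).width (splitInst φ c) = Nat.size (2 * ((splitOV φ c).n * (splitOV φ c).d) + 2) :=
  inputWidth_encode_splitOV φ hc

/-! ### Accepted outputs and size of `k`-SAT instances -/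

open scoped Classical in
/-- Accepted outputs of `kSATProblem k`: `[1]` iff satisfiable. [folklore] -/
theorem kSATProblem_good_iff (k : ℕ) (φ : (kSATProblem k).Inst) (out : List ℕ) :
    out ∈ (kSATProblem k).Good φ ↔ out = [if φ.1.Satisfiable then 1 else 0] := by
  change out ∈ CNFSAT.Good φ.1 ↔ _
  rw [CNFSAT_good_iff]

/-- The size of a CNF of width `≤ k` is at most `k` per clause. [folklore] -/
theorem size_le_mul_of_isWidthLE {k : ℕ} {φ : CNF ℕ} (hw : φ.IsWidthLE k) :
    φ.size ≤ k * φ.length := by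
  unfold CNF.size
  induction φ with
  | nil => simp
  | cons C φ ih =>
    simp only [List.map_cons, List.sum_cons, List.length_cons]
    have h1 := hw C (by simp)
    have h2 := ih (fun D hD => hw D (by simp [hD]))
    nlinarith

end OVRed

end Literature.Computability.FineGrained
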